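import Summits.QuantumFields.YangMills.Theorems.UnitScaleTiltProp8ChartHInvTent
import Literature.MathematicalPhysics.QuantumFieldTheory.Balaban1983to89.B5RowSumsP12Lattice
import Literature.MathematicalPhysics.QuantumFieldTheory.Balaban1983to89.B10StarCount
import HarnessLib

/-!
# K0⁷ STUB 1 (`stub_prop8StepCoP13`), sub-target S4b — THE CHART BLOCK OF THE SECT. F CAPSTONE AT THE RECORD, part 5:
# **THE ONE-STEP COLLAR `hcollar` OF THE CAPSTONE FROM (2.2)-ADMISSIBILITY** — for every nested family `D` with `Adm22 D R M`, `1 ≤ R·M`, the territories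
# `Ω_j := {x | D.InOm j x}` of fine sites satisfy `x ∈ Ω_{j+1} ⇒ x ± e_ν ∈ Ω_j`: the hypothesis `hcollar` of `K0Stub1SectFWSlotOneLevel.exists_sectF_W_levOf`
# (and of g0's `…V0SlotAtRecordLevels`, brick 9's `…V0CurrentFrechet`) discharged for EVERY admissible family at once

Cell `pub-ymgap`, width seat `pub-ymgap-k0-s1-w2` g3 (INTENT-5).  `--kind proof --supports stmt-QuantumFields-20541 --as helper`; count-neutral.
[B6] = [Balaban1984PropagatorsII]; [15] = [Balaban1985Variational].

WHY.  The multi-level V₀-slot of the capstone reads the (115)-weights `w m b = (L^{j(b)}η)^m`, `j(b) = levOf Ω k b₋`, and needs the one-step oscillation of the level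
function `≤ 1`, i.e. `hcollar : ∀ j x ν, x ∈ Ω (j+1) → x.shift ν ∈ Ω j ∧ x.unshift ν ∈ Ω j`.  At the record `Ω j = {x : Site P 0 | D.InOm j x}` (`IsLevWeight`, dag-n07-w2 ∕
k0-s1-w3's currency), and [B6] (2.2) «dist(Ω_{j+1}, Ω_jᶜ) > RM L^jξ» gives it with room to spare: the `j`-blocks of the two end-points of a fine bond are within sup-distance
`1 ≤ RM` (the route `UnitScaleTilt`'s `ChartHInv.distSite_iterBlockOf_endpoints_le_one`).

WHAT IS PROVED (sorry-free; no definition; axioms standard).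
* ★★ `inOm_endpoints_of_adm22` — `Adm22 D R M`, `1 ≤ R·M`, `b` a fine bond: `D.InOm (j+1) b.src ∨ D.InOm (j+1) b.tgt → D.InOm j b.src ∧ D.InOm j b.tgt`.
* ★★ `oneStepCollar_of_adm22` — THE CAPSTONE's `hcollar` VERBATIM at `Ω := fun j => {x : Site P 0 | D.InOm j x}`:
  `∀ j x ν, x ∈ Ω (j+1) → x.shift ν ∈ Ω j ∧ x.unshift ν ∈ Ω j`.
HONEST SCOPE.  Lattice bookkeeping from [B6] (2.2); nothing of [15] asserted; `stub_prop8StepCoP13` ∕ K0⁷ NOT closed; N07 NOT discharged; counts unmoved (28∕28 · 5∕27);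
one finite 𝕋⁴ programme at fixed ε — R4 closes the conditional finite-𝕋⁴ rung `BalabanLadder.UV` only, never the summit; the YM mass gap (Clay) is NOT proved by any of this;
nothing continuum ∕ ℝ⁴ ∕ OS.  No `sorry`, no `def`, no `instance`, no `notation`.

References: [B6] (2.1)–(2.3) p.224; [15] (115) p.294, (152) p.301.
-/

noncomputable section

namespace Summit.QuantumFields.YangMills.Theorems.K0Stub1OneStepCollarOfAdm22

open Literature.MathematicalPhysics.QuantumFieldTheory.Balaban1983to89
open B5Eq118OneStroke (iterBlockOf iterBlockOf_succ)
open B5Prop12FieldsLattice (distSite)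
open B5RowSumsP12Lattice (distSite_comm)
open B5Eq117TorusCarriers (Mk)
open B6SectADomainsV1 (Domains)
open Summit.QuantumFields.YangMills.Theorems.FlatCubeOpsText (Adm22)
open Summit.QuantumFields.YangMills.Theorems.ChartHInv (distSite_iterBlockOf_endpoints_le_one)

variable {P : Params}

/-- ★★ **BOTH END-POINTS OF A FINE BOND ARE IN `Ω_j` AS SOON AS ONE OF THEM IS IN `Ω_{j+1}`** (`Adm22 D R M`, `1 ≤ R·M`): the `j`-blocks of the end-points are within
sup-distance `1`, and (2.2) separates `Ω_{j+1}` from `Ω_jᶜ` by more than `R·M ≥ 1` at level `j`. [cite: Balaban1984PropagatorsII, (2.2) p.224] -/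
theorem inOm_endpoints_of_adm22 (D : Domains P) {R M : ℕ} (hAdm : Adm22 D R M) (hRM : 1 ≤ R * M) (j : ℕ) (b : PBond P 0)
    (hb : D.InOm (j + 1) b.src ∨ D.InOm (j + 1) b.tgt) : D.InOm j b.src ∧ D.InOm j b.tgt := by
  -- the level is in the standing range (no domains beyond level `k ≤ m + K`)
  have hj : j + 1 ≤ D.k := by
    by_contra h
    have hempty := D.Om_eq_empty (lt_of_not_ge h)
    rcases hb with hb | hb <;>
    · unfold Domains.InOm at hb
      rw [hempty] at hb
      exact absurd hb (Finset.notMem_empty _)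
  have hjmK : j ≤ P.m + P.K := by have := D.hk; omega
  -- the two `j`-blocks are within sup-distance `1 ≤ R·M`
  have hdist := distSite_iterBlockOf_endpoints_le_one (P := P) hjmK b
  have hRM' : (1 : ℝ) ≤ ((R * M : ℕ) : ℝ) := by exact_mod_cast hRM
  -- (2.2): a `j`-site whose block lies in `Ω_{j+1}` is more than `R·M` away from `Ω_jᶜ`
  have key : ∀ y y' : Site P j, blockOf y ∈ D.Om (j + 1) → distSite (Mk P j) y y' ≤ 1 → y' ∈ D.Om j := by
    intro y y' hy hyy'
    by_contra hout
    have h := hAdm.2 j y y' hy hout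
    linarith
  rcases hb with hsrc | htgt
  · have hblk : blockOf (iterBlockOf j b.src) ∈ D.Om (j + 1) := by
      rw [← iterBlockOf_succ]; exact hsrc
    exact ⟨D.nested _ hblk, key _ _ hblk hdist⟩
  · have hblk : blockOf (iterBlockOf j b.tgt) ∈ D.Om (j + 1) := by
      rw [← iterBlockOf_succ]; exact htgt
    refine ⟨key _ _ hblk ?_, D.nested _ hblk⟩
    rw [distSite_comm]; exact hdist

/-- ★★ **THE CAPSTONE's ONE-STEP COLLAR `hcollar` FOR EVERY (2.2)-ADMISSIBLE FAMILY** (`Adm22 D R M`, `1 ≤ R·M`), at `Ω j := {x : Site P 0 | D.InOm j x}`: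
`x ∈ Ω_{j+1} ⇒ x + e_ν ∈ Ω_j ∧ x − e_ν ∈ Ω_j` — the hypothesis `hcollar` of `K0Stub1SectFWSlotOneLevel.exists_sectF_W_levOf` ∕ `K0Stub1V0SlotAtRecordLevels` ∕
`K0Stub1V0CurrentFrechet` (multi-level weights `w m b = (L^{j(b)}η)^m` = `K0FlatCubeOpsTextP.IsLevWeight`). [cite: Balaban1984PropagatorsII, (2.2) p.224; Balaban1985Variational, (115) p.294] -/
theorem oneStepCollar_of_adm22 (D : Domains P) {R M : ℕ} (hAdm : Adm22 D R M) (hRM : 1 ≤ R * M) :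
    ∀ (j : ℕ) (x : Site P 0) (ν : Fin P.d),
      x ∈ (fun i => {y : Site P 0 | D.InOm i y}) (j + 1) →
        x.shift ν ∈ (fun i => {y : Site P 0 | D.InOm i y}) j ∧ x.unshift ν ∈ (fun i => {y : Site P 0 | D.InOm i y}) j := by
  intro j x ν hx
  simp only [Set.mem_setOf_eq] at hx ⊢
  constructor
  · -- the bond `⟨x, ν⟩`: `src = x`, `tgt = x + e_ν`
    exact (inOm_endpoints_of_adm22 D hAdm hRM j ⟨x, ν⟩ (Or.inl hx)).2
  · -- the bond `⟨x − e_ν, ν⟩`: `tgt = x`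
    have h := inOm_endpoints_of_adm22 D hAdm hRM j ⟨x.unshift ν, ν⟩ (Or.inr (by
      show D.InOm (j + 1) ((x.unshift ν).shift ν)
      rw [B10StarCount.shift_unshift]; exact hx))
    exact h.1

end Summit.QuantumFields.YangMills.Theorems.K0Stub1OneStepCollarOfAdm22

end
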